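import Mathlib
import HarnessLib
import Summits.PneNP.PneNP.Theses.CnfIdealGenLength
import Summits.PneNP.PneNP.Theorems.CnfIdealGenLengthRankCount
import Summits.PneNP.PneNP.Theorems.CnfIdealGenLengthFregeShortensGenLength
import Summits.PneNP.PneNP.Theorems.CnfIdealGenLengthRankDefectRepresentationsPhantomClosure

/-!
# Crux `RankDefectRepresentations` (stmt-PneNP-18923): the FREGE CEILING, kernel-checked

Why the crux (and the hard stub S1 of the line `phantom-kernel`) is a FRONTIER rung (lead prover, 2026-08-27): a
proof of `RankDefectRepresentations` is a SUPERPOLYNOMIAL FREGE LOWER BOUND.  Assembled from tree theorems only: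
RDR ⇒ `GenLengthSuperpoly` (`genLengthSuperpoly_of_rankDefectRepresentations`, p541615) and the PROVED route item
`FregeShortensGenLength` (`cnfIdealGenLength_fregeShortensGenLength_proof`, p540918: a polynomially bounded Frege
system would give polynomial two-sided representations of the clause products), which meet at some `n`.  Hence
`not_isPolyBounded_of_rankDefectRepresentations : RDR → ∀ F, IsFrege F → ¬ F.IsPolyBounded`, and through the
landed transfer `rankDefectRepresentations_of_contradictoryPhantoms` (p580392) the same for contradictory phantoms
(`not_isPolyBounded_of_contradictoryPhantoms`).  HONEST FRAMING: this is the refuter vet's "ceiling" (item note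
15:46Z) as a theorem; it does not move P ≠ NP — it says the item sits exactly at the Frege frontier F-N2.
-/

set_option linter.dupNamespace false -- `Summit.PneNP.PneNP.…`: summit = sub-problem name (D-0017)

namespace Summit.PneNP.PneNP.Theorems.CnfIdealGenLength

open Filter
open Literature.Computability.Complexity
open Literature.Computability.MetaComplexity
open Literature.Computability.MetaComplexity.NCIPS

/-- **Frege ceiling of the crux.** `RankDefectRepresentations` implies that NO Frege system is polynomially bounded
(i.e. a superpolynomial Frege lower bound, for the tautologies `¬φ_n` of the witnessing family). [folklore] -/
theorem not_isPolyBounded_of_rankDefectRepresentations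
    (h : Summit.PneNP.PneNP.Theses.CnfIdealGenLength.RankDefectRepresentations)
    (F : FregeSystem) (hF : IsFrege F) : ¬ F.IsPolyBounded := by
  intro hpb
  obtain ⟨p, φ, hgood, hbig⟩ := genLengthSuperpoly_of_rankDefectRepresentations h
  obtain ⟨c, hsmall⟩ := Summit.PneNP.PneNP.Theorems.cnfIdealGenLength_fregeShortensGenLength_proof F hF hpb p φ hgood
  obtain ⟨n, hn⟩ := ((hbig c).and hsmall).exists
  exact hn.1 hn.2

/-- **Frege ceiling of the line `phantom-kernel`.** Contradictory phantoms (the hard stub S1, unfolded) imply that no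
Frege system is polynomially bounded. [folklore] -/
theorem not_isPolyBounded_of_contradictoryPhantoms
    (hS1 : ∃ w : ℕ, ∀ c : ℕ, ∀ᶠ n : ℕ in atTop, ∃ (K : Type) (_ : Field K) (_ : CharZero K) (d t : ℕ)
      (M : Fin n → Matrix (Fin d) (Fin d) K) (U : Submodule K (Fin d → K)),
      (∀ g : MonoidAlgebra K (FreeMonoid (Fin n)), IsAxiom g →
        (MonoidAlgebra.lift K (Matrix (Fin d) (Fin d) K) (FreeMonoid (Fin n)) (FreeMonoid.lift M) g).rank
          ≤ t) ∧
      n ^ c * t < Module.finrank K U ∧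
      ∀ σ : Fin n → Bool, ∃ κ : Clause (Fin n), κ.length ≤ w ∧
        (∀ u ∈ U, (MonoidAlgebra.lift K (Matrix (Fin d) (Fin d) K) (FreeMonoid (Fin n))
          (FreeMonoid.lift M) (clauseWord K κ)).mulVec u = 0) ∧
        Clause.eval σ κ = false)
    (F : FregeSystem) (hF : IsFrege F) : ¬ F.IsPolyBounded :=
  not_isPolyBounded_of_rankDefectRepresentations (rankDefectRepresentations_of_contradictoryPhantoms hS1) F hF

end Summit.PneNP.PneNP.Theorems.CnfIdealGenLength
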